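import Literature.AnabelianGeometry.EtaleTheta.SettingModelCyclotomicCharacter
import Literature.AnabelianGeometry.EtaleTheta.CyclotomeZHatEquiv
import HarnessLib

/-!
# The cyclotomic character transported along ANY identification `Λ(ℚ̄_pˣ) ≅ Ẑ`:
# `e(σ • ζ) = χ(σ) · e(ζ)` — `Aut(Ẑ)` is commutative, so the choice of `e` does not matter (proof-only)

Classical profinite bookkeeping [RibesZalesskii2010, Thm 2.7.1] (`Ẑ = lim ℤ/n`, `Aut(Ẑ) = Ẑ^×` is ABELIAN);
S. Mochizuki, *The étale theta function …*, Publ. RIMS **45** (2009) [EtTh], §1 p. 13 (the cyclotomic character of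
`G_K` on `μ_N`) [cite: MochizukiEtTh2009, §1 p.13].  abc-iut cell, layer L2, seat abc-iut-w5-d091 (gen 4); companion of
`SettingModelCyclotomicCharacter` (R78 cluster, file F3) answering the F6 shape request of abc-iut-L6-d6 /
abc-iut-w5-d171 («`chi_spec : cycloZHat p (σ • ζ) = chi p σ (cycloZHat p ζ)`»).  ONE definition (the cluster's
CHOSEN identification `cycloZHat p : Λ(ℚ̄_pˣ) ≃* Ẑ`, so that F1c / F3c / F6 all use the SAME one), otherwise proofs;
no instance, no named fact:

* `ZHatLevel.mulAut_comm` — **`Aut(Ẑ)` is commutative** (an automorphism is determined by its level characters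
  `χ_n`, abc-iut-w5-d010's `ZHatLevel.eq_of_levelChar_eq`, and each `χ_n` is a homomorphism to the commutative
  `(ℤ/nℤ, ·)`);
* `cyclotome.mulEquiv_apply_zhatTwist` — for a domain `R` with enough roots of unity and **ANY** isomorphism
  `e : Λ(R^×) ≃* Ẑ`: `e (zhatTwist u ζ) = u (e ζ)` (first for a generator-normalised `e₀` by comparing levels —
  discrete logarithms multiply by `χ_n(u)` —, then for `e = v ∘ e₀` by commutativity);
* `SettingModel.mulEquiv_apply_galUnits` — **for every `e : Λ(ℚ̄_pˣ) ≃* Ẑ` and `σ ∈ G_{ℚ_p}`: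
  `e(σ • ζ) = χ(σ) (e ζ)`**, i.e. every identification of the cyclotome of `ℚ̄_p` with `Ẑ` is automatically
  `χ`-equivariant (the coefficient isomorphism `Λ(ℚ̄_pˣ) ≅ Δ_Θ` of the χ-twisted model may be taken to be ANY `e`
  composed with F1's `Ẑ ≅ Δ_Θ`);
* `SettingModel.cycloZHat p` — THE chosen `e` of the R78 cluster (`(cyclotome.padicAlgCl_nonempty_mulEquiv_zHat p).some`,
  abc-iut-w5-d010's existence theorem) with `cycloZHat_map_galUnits : cycloZHat p (σ • ζ) = χ(σ) (cycloZHat p ζ)` and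
  the inverse form `cycloZHat_symm_chi`.

Nothing here bears on [IUTchIII] Cor. 3.12; a model is consistency evidence only.
-/

noncomputable section

open CategoryTheory ProfiniteGrp ProfiniteGrp.ProfiniteCompletion

namespace Literature.AnabelianGeometry.EtaleTheta

/-! ### `Aut(Ẑ)` is commutative -/

namespace ZHatLevel

/-- **`Aut(Ẑ) = Ẑ^×` is commutative**: `φ ψ = ψ φ` for all abstract group automorphisms of `Ẑ` (both sides have
the same level characters `χ_n(φ) χ_n(ψ) ∈ ℤ/nℤ`, and `Aut(Ẑ)` is determined by its level characters).
[cite: RibesZalesskii2010, Thm 2.7.1] -/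
theorem mulAut_comm (φ ψ : MulAut (completion (GrpCat.of (Multiplicative ℤ)))) : φ * ψ = ψ * φ :=
  eq_of_levelChar_eq fun n => by rw [map_mul, map_mul, mul_comm]

end ZHatLevel

/-! ### Any identification `Λ(R^×) ≅ Ẑ` intertwines the `Ẑ^×`-twist with the tautological action -/

namespace cyclotome

universe u

variable {R : Type u} [CommRing R] [IsDomain R]

omit [IsDomain R] in
/-- For a GENERATOR-NORMALISED identification `e₀ : Λ(R^×) ≃* Ẑ` (`ζ_n = ξ_n ^ level_n(e₀ ζ)` for a compatible
system `ξ` of primitive roots), `e₀ (u · ζ) = u (e₀ ζ)`: at level `n` both sides have discrete logarithm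
`χ_n(u) · log_ξ(ζ_n)`. [cite: RibesZalesskii2010, Thm 2.7.1] -/
theorem mulEquiv_apply_zhatTwist_of_generator {ξ : cyclotome Rˣ}
    (hξ : ∀ n : ℕ+, IsPrimitiveRoot ((ξ : ℕ+ → Rˣ) n) (n : ℕ))
    {e₀ : cyclotome Rˣ ≃* completion (GrpCat.of (Multiplicative ℤ))}
    (hlog : ∀ (ζ : cyclotome Rˣ) (n : ℕ+),
      (ξ : ℕ+ → Rˣ) n ^ (Multiplicative.toAdd (ZHatLevel.level n (e₀ ζ))).val = (ζ : ℕ+ → Rˣ) n)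
    (u : MulAut (completion (GrpCat.of (Multiplicative ℤ)))) (ζ : cyclotome Rˣ) :
    e₀ (zhatTwist Rˣ u ζ) = u (e₀ ζ) := by
  refine ZHatLevel.ext_of_level fun n => ?_
  haveI : NeZero (n : ℕ) := ⟨n.ne_zero⟩
  apply Multiplicative.toAdd.injective
  rw [ZHatLevel.toAdd_level_aut]
  -- discrete logarithms at level `n`: `L` of `e₀ (u · ζ)`, `a` of `e₀ ζ`, and `c = χ_n(u)`
  set L := (Multiplicative.toAdd (ZHatLevel.level n (e₀ (zhatTwist Rˣ u ζ)))).val with hL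
  set a := (Multiplicative.toAdd (ZHatLevel.level n (e₀ ζ))).val with ha
  set c := (ZHatLevel.levelChar n u).val with hc
  have h1 : (ξ : ℕ+ → Rˣ) n ^ L = ((zhatTwist Rˣ u ζ : cyclotome Rˣ) : ℕ+ → Rˣ) n := hlog _ n
  have h2 : ((zhatTwist Rˣ u ζ : cyclotome Rˣ) : ℕ+ → Rˣ) n = (ζ : ℕ+ → Rˣ) n ^ c := zhatTwist_apply_coe u ζ n
  have h3 : (ζ : ℕ+ → Rˣ) n = (ξ : ℕ+ → Rˣ) n ^ a := (hlog ζ n).symm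
  have h4 : (ξ : ℕ+ → Rˣ) n ^ L = (ξ : ℕ+ → Rˣ) n ^ (a * c) := by rw [h1, h2, h3, ← pow_mul]
  have hmod : L % (n : ℕ) = (a * c) % (n : ℕ) := (pow_eq_pow_iff_mod_eq (hξ n) _ _).mp h4
  have hZ : ((L : ℕ) : ZMod n) = ((a * c : ℕ) : ZMod n) := (ZMod.natCast_eq_natCast_iff' _ _ _).mpr hmod
  have hL' : ((L : ℕ) : ZMod n) = Multiplicative.toAdd (ZHatLevel.level n (e₀ (zhatTwist Rˣ u ζ))) :=
    ZMod.natCast_zmod_val _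
  have ha' : ((a : ℕ) : ZMod n) = Multiplicative.toAdd (ZHatLevel.level n (e₀ ζ)) := ZMod.natCast_zmod_val _
  have hc' : ((c : ℕ) : ZMod n) = ZHatLevel.levelChar n u := ZMod.natCast_zmod_val _
  rw [← hL', hZ, Nat.cast_mul, ha', hc', mul_comm]

/-- **Every identification `e : Λ(R^×) ≃* Ẑ` intertwines the `Ẑ^×`-twist with the tautological action of
`Aut(Ẑ)`**: `e (zhatTwist u ζ) = u (e ζ)` (`R` a domain with a primitive `n`-th root of unity for every `n ≥ 1`).
Proof: true for a generator-normalised `e₀` (`mulEquiv_apply_zhatTwist_of_generator`); a general `e` is `v ∘ e₀` with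
`v ∈ Aut(Ẑ)`, and `Aut(Ẑ)` is commutative (`ZHatLevel.mulAut_comm`). [cite: RibesZalesskii2010, Thm 2.7.1] -/
theorem mulEquiv_apply_zhatTwist (hprim : ∀ n : ℕ, 0 < n → ∃ ζ : R, IsPrimitiveRoot ζ n)
    (e : cyclotome Rˣ ≃* completion (GrpCat.of (Multiplicative ℤ)))
    (u : MulAut (completion (GrpCat.of (Multiplicative ℤ)))) (ζ : cyclotome Rˣ) :
    e (zhatTwist Rˣ u ζ) = u (e ζ) := by
  obtain ⟨ξ, hξ⟩ := exists_generator hprim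
  obtain ⟨e₀, -, hlog⟩ := exists_mulEquiv_zHat_of_generator ξ hξ
  -- `e = v ∘ e₀` with `v := e₀⁻¹ ≫ e ∈ Aut(Ẑ)`
  set v : MulAut (completion (GrpCat.of (Multiplicative ℤ))) := e₀.symm.trans e with hv
  have he : ∀ ζ', e ζ' = v (e₀ ζ') := fun ζ' => by
    rw [hv, MulEquiv.trans_apply, MulEquiv.symm_apply_apply]
  rw [he, he, mulEquiv_apply_zhatTwist_of_generator hξ hlog u ζ, ← MulAut.mul_apply, ← MulAut.mul_apply,
    ZHatLevel.mulAut_comm v u]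

end cyclotome

/-! ### The cyclotomic character of `G_{ℚ_p}` transported along any `Λ(ℚ̄_pˣ) ≅ Ẑ` -/

namespace SettingModel

open Literature.AnabelianGeometry.SemiGraphs (GQp)

variable (p : ℕ) [Fact p.Prime]

/-- **`e(σ • ζ) = χ(σ) · e(ζ)` for EVERY identification `e : Λ(ℚ̄_pˣ) ≃* Ẑ`**: the Galois action on the cyclotome
of `ℚ̄_p` (`cyclotome.map (galUnits p σ)`) corresponds under ANY `e` to the tautological action of
`χ(σ) ∈ Aut(Ẑ) = Ẑ^×` (`chi_spec` + `cyclotome.mulEquiv_apply_zhatTwist`). So the coefficient isomorphism of the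
χ-twisted model may use an arbitrary `e` (e.g. `(cyclotome.padicAlgCl_nonempty_mulEquiv_zHat p).some`).
[cite: MochizukiEtTh2009, §1 p.13] -/
theorem mulEquiv_apply_galUnits (e : cyclotome (PadicAlgCl p)ˣ ≃* completion (GrpCat.of (Multiplicative ℤ)))
    (σ : GQp p) (ζ : cyclotome (PadicAlgCl p)ˣ) :
    e (cyclotome.map (galUnits p σ).toMonoidHom ζ) = chi p σ (e ζ) := by
  rw [chi_spec]
  exact cyclotome.mulEquiv_apply_zhatTwist (exists_isPrimitiveRoot_padicAlgCl p) e (chi p σ) ζ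

/-- The same with the transport read as an action on `Ẑ`: the automorphism `e ∘ Λ(σ) ∘ e⁻¹` of `Ẑ` IS `χ(σ)`.
[cite: MochizukiEtTh2009, §1 p.13] -/
theorem mulEquiv_conj_galUnits_eq_chi (e : cyclotome (PadicAlgCl p)ˣ ≃* completion (GrpCat.of (Multiplicative ℤ)))
    (σ : GQp p) (z : completion (GrpCat.of (Multiplicative ℤ))) :
    e (cyclotome.map (galUnits p σ).toMonoidHom (e.symm z)) = chi p σ z := by
  rw [mulEquiv_apply_galUnits, MulEquiv.apply_symm_apply]

/-- **THE chosen identification `Λ(ℚ̄_pˣ) ≃* Ẑ` of the χ-twisted root model** (R78 cluster: F1c's `Ẑ ≅ Δ_Θ`,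
F3c's Kummer cocycle `κ_q`, F6's coefficient isomorphism all go through THIS `e`; by `mulEquiv_apply_galUnits` any
other choice would do, this one is fixed for bookkeeping only).  Existence: abc-iut-w5-d010's
`cyclotome.padicAlgCl_nonempty_mulEquiv_zHat` ([SemiAnbd] Thm 6.12 «`μ_Ẑ(K̄) ≅ Ẑ(1)`»). [cite: MochizukiEtTh2009, §1 p.13] -/
def cycloZHat : cyclotome (PadicAlgCl p)ˣ ≃* completion (GrpCat.of (Multiplicative ℤ)) :=
  (cyclotome.padicAlgCl_nonempty_mulEquiv_zHat p).some

/-- **`cycloZHat p (σ • ζ) = χ(σ) (cycloZHat p ζ)`** — the cluster's coefficient identification is `χ`-equivariant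
(the shape asked for by abc-iut-L6-d6's R78-MAP #2 (F1/F3-c)). [cite: MochizukiEtTh2009, §1 p.13] -/
theorem cycloZHat_map_galUnits (σ : GQp p) (ζ : cyclotome (PadicAlgCl p)ˣ) :
    cycloZHat p (cyclotome.map (galUnits p σ).toMonoidHom ζ) = chi p σ (cycloZHat p ζ) :=
  mulEquiv_apply_galUnits p (cycloZHat p) σ ζ

/-- Inverse form: `cycloZHat⁻¹ (χ(σ) z) = σ • cycloZHat⁻¹ z` — the Galois action on `Λ(ℚ̄_pˣ)` read on `Ẑ` IS
`χ`. [cite: MochizukiEtTh2009, §1 p.13] -/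
theorem cycloZHat_symm_chi (σ : GQp p) (z : completion (GrpCat.of (Multiplicative ℤ))) :
    (cycloZHat p).symm (chi p σ z) = cyclotome.map (galUnits p σ).toMonoidHom ((cycloZHat p).symm z) := by
  apply (cycloZHat p).injective
  rw [MulEquiv.apply_symm_apply, cycloZHat_map_galUnits, MulEquiv.apply_symm_apply]

end SettingModel

end Literature.AnabelianGeometry.EtaleTheta

end
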